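import Mathlib.GroupTheory.Index
import Mathlib.Tactic
import HarnessLib

/-!
# Cell «bsd-uniform», track U2, route C — T4-PROOF Lemma L1 (no `2`-torsion up the ring class
# tower), COMBINATORIAL HALF: a generalized dihedral group acting on an abelian group with at most
# three non-zero `2`-torsion elements, none of them fixed (pure algebra, sorry-free)

HONEST FRAMING (cell «bsd-uniform», run/shared/lean/pub/bsd-uniform/, seat u2-p1): PURE ALGEBRA; no
field, no curve, no claim about the Birch–Swinnerton-Dyer conjecture. With u2-p3's group-theoretic
half (`RingClassNoTwoTorsionGroup.lean`: no `C₃` quotient; the `S₃` quotient) this is the input of the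
FIELD half (`RingClassNoTwoTorsion.lean`, this seat), which turns route C's binder L1
`h2L : E(K[|d|])[2] = 0` (HOME/RESIDUE.md §U2 row R2-9) into a theorem under the Heegner hypothesis.
The argument here replaces the `C₃ / S₃` Galois-group bookkeeping of T4-PROOF.md v1.9b §3 L1 by an
elementary analysis of the action on the (at most three) non-zero `2`-torsion POINTS, which needs no
Galois correspondence:

Setting: a group `Γ` acting additively on `M` (`ρ : Γ →* AddMonoid.End M`; in L1: `Γ = Aut(K[n]/ℚ)`
on `M = E(K[n])`), a subgroup `A` (`= Gal(K[n]/K)`) whose elements commute, `τ ∉ A` with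
`τ a τ⁻¹ = a⁻¹` on `A` and `Γ = A ∪ τA` (Cox Lemma 9.3 — the tree's
`RingClassFieldConjugation.lean`); the set `T = M[2] ∖ 0` of non-zero `2`-torsion elements admits an
injection into a set of at most three elements (the `x`-coordinate into the roots of the `2`-division
cubic) and contains NO `Γ`-fixed element (no rational `2`-torsion, (H-2)).
* §1–§2: `ρ g` permutes `T`; if `P ≠ Q ∈ T` then `T = {P, Q, P + Q}` and every `g` induces one of the
  six permutations of this triple (`perm_cases`).
* §3: (H1) nothing in `T` is fixed by `A` and `τ`; (H2) `τ` maps `A`-fixed elements to `A`-fixed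
  elements (`bτ = τb⁻¹`); (H3) hence NO element of `T` is `A`-fixed (`exists_apply_ne`).
* §5: every `b ∈ A` induces the identity or a `3`-cycle (a transposition's fixed point would be
  `A`-fixed, `A` abelian) — so `b³` fixes `T` pointwise (`apply_apply_apply_eq`); `τ` induces a
  transposition (`τ̄ = id` would give `b̄ = b̄⁻¹` for a `3`-cycle `b̄`; a `3`-cycle `τ̄` contradicts
  `τ⁴ = 1`, which follows from `τ² ∈ A` being inverted by `τ`) (`cases_tau`).
* §6 `exists_triple`: the STRUCTURE THEOREM — given one `Q ∈ T` there are exactly three elements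
  `P₁, P₂, P₃` of `T`, the cube of every element of `A` fixes them, and `τ` swaps `P₁, P₂` and fixes
  `P₃`. (The field half then evaluates `δ = (x₁−x₂)(x₁−x₃)(x₂−x₃)`, `δ² = Δ/16`: `A` fixes `δ`, `τ`
  negates it, so `√Δ ∈ K ∖ ℚ`, i.e. `K = ℚ(√Δ_E)` — excluded by the Heegner hypothesis.)

References: T4-PROOF.md v1.9b §3 L1 (HOME, b2b/bsd-rank1-residual/p2/idea-2/); D. A. Cox, *Primes of
the form x² + ny²*, 2nd ed., Lemma 9.3 [Cox2013]; J. H. Silverman, AEC, III.§1 (the `2`-torsion of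
`E` is `E[2] ≅ (ℤ/2)²`, `x`-coordinates = roots of the `2`-division cubic) [SilvermanAEC2009].
-/

set_option autoImplicit false

namespace Summit.BirchSwinnertonDyer.Uniform.U2.TwoTorsionDihedral

variable {M : Type*} [AddCommGroup M] {Γ : Type*} [Group Γ] (ρ : Γ →* AddMonoid.End M)

/-! ## §1 Generalities: the action is by injective additive maps preserving `M[2] ∖ 0` -/

/-- `ρ (g * h) P = ρ g (ρ h P)`. [folklore] -/
theorem mul_apply (g h : Γ) (P : M) : ρ (g * h) P = ρ g (ρ h P) := by
  rw [map_mul]; rfl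

/-- `ρ g⁻¹ (ρ g P) = P`. [folklore] -/
theorem inv_apply_apply (g : Γ) (P : M) : ρ g⁻¹ (ρ g P) = P := by
  rw [← mul_apply, inv_mul_cancel, map_one]; rfl

/-- `ρ g (ρ g⁻¹ P) = P`. [folklore] -/
theorem apply_inv_apply (g : Γ) (P : M) : ρ g (ρ g⁻¹ P) = P := by
  rw [← mul_apply, mul_inv_cancel, map_one]; rfl

/-- Each `ρ g` is injective. [folklore] -/
theorem apply_injective (g : Γ) : Function.Injective (ρ g) := fun P Q h => by
  rw [← inv_apply_apply ρ g P, h, inv_apply_apply]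

/-- `ρ g P = 0 ↔ P = 0`. [folklore] -/
theorem apply_eq_zero_iff (g : Γ) (P : M) : ρ g P = 0 ↔ P = 0 := by
  constructor
  · intro h
    exact apply_injective ρ g (by rw [h, map_zero])
  · rintro rfl; rw [map_zero]

/-- `ρ g` preserves "non-zero `2`-torsion". [folklore] -/
theorem apply_mem (g : Γ) {P : M} (hP : P ≠ 0 ∧ (2 : ℕ) • P = 0) :
    ρ g P ≠ 0 ∧ (2 : ℕ) • ρ g P = 0 :=
  ⟨fun h => hP.1 ((apply_eq_zero_iff ρ g P).mp h), by rw [← map_nsmul, hP.2, map_zero]⟩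

/-- A `2`-torsion element is its own negative: `P + P = 0`. [folklore] -/
theorem add_self_eq_zero {P : M} (hP : (2 : ℕ) • P = 0) : P + P = 0 := by
  rwa [two_nsmul] at hP

/-- The sum of two distinct non-zero `2`-torsion elements is a third one. [folklore] -/
theorem add_mem {P Q : M} (hP : P ≠ 0 ∧ (2 : ℕ) • P = 0) (hQ : Q ≠ 0 ∧ (2 : ℕ) • Q = 0)
    (hPQ : P ≠ Q) : P + Q ≠ 0 ∧ (2 : ℕ) • (P + Q) = 0 := by
  refine ⟨fun h => hPQ ?_, by rw [smul_add, hP.2, hQ.2, add_zero]⟩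
  have hPP := add_self_eq_zero hP.2
  -- `P + Q = 0 = P + P` ⇒ `Q = P`
  exact add_left_cancel (hPP.trans h.symm)

/-! ## §2 A triple `P₁, P₂, P₃ = P₁ + P₂` exhausting `M[2] ∖ 0`: the six permutations -/

section Triple

variable {ρ}
variable {P₁ P₂ : M} (h₁ : P₁ ≠ 0 ∧ (2 : ℕ) • P₁ = 0) (h₂ : P₂ ≠ 0 ∧ (2 : ℕ) • P₂ = 0)
  (h12 : P₁ ≠ P₂)
  (hall : ∀ P : M, P ≠ 0 ∧ (2 : ℕ) • P = 0 → P = P₁ ∨ P = P₂ ∨ P = P₁ + P₂)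

include h₁ in
/-- `P₁ + (P₁ + P₂) = P₂`. [folklore] -/
theorem add_add_eq_right : P₁ + (P₁ + P₂) = P₂ := by
  rw [← add_assoc, add_self_eq_zero h₁.2, zero_add]

include h₂ in
/-- `P₂ + (P₁ + P₂) = P₁`. [folklore] -/
theorem add_add_eq_left : P₂ + (P₁ + P₂) = P₁ := by
  rw [add_comm P₁ P₂, ← add_assoc, add_self_eq_zero h₂.2, zero_add]

include h₁ h₂ h12 hall in
/-- **The six permutations.** Every `g` acts on `{P₁, P₂, P₃}` (`P₃ = P₁ + P₂`) as one of: the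
identity, the transposition fixing `P₁`, the transposition fixing `P₃`, the two `3`-cycles, the
transposition fixing `P₂` — listed by the images `(ρ g P₁, ρ g P₂)`; the image of `P₃` is their sum.
[folklore] -/
theorem perm_cases (g : Γ) :
    (ρ g P₁ = P₁ ∧ ρ g P₂ = P₂) ∨ (ρ g P₁ = P₁ ∧ ρ g P₂ = P₁ + P₂) ∨
    (ρ g P₁ = P₂ ∧ ρ g P₂ = P₁) ∨ (ρ g P₁ = P₂ ∧ ρ g P₂ = P₁ + P₂) ∨
    (ρ g P₁ = P₁ + P₂ ∧ ρ g P₂ = P₁) ∨ (ρ g P₁ = P₁ + P₂ ∧ ρ g P₂ = P₂) := by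
  have hne : ρ g P₁ ≠ ρ g P₂ := fun h => h12 (apply_injective ρ g h)
  rcases hall _ (apply_mem ρ g h₁) with ha | ha | ha <;>
    rcases hall _ (apply_mem ρ g h₂) with hb | hb | hb
  · exact absurd (ha.trans hb.symm) hne
  · exact Or.inl ⟨ha, hb⟩
  · exact Or.inr (Or.inl ⟨ha, hb⟩)
  · exact Or.inr (Or.inr (Or.inl ⟨ha, hb⟩))
  · exact absurd (ha.trans hb.symm) hne
  · exact Or.inr (Or.inr (Or.inr (Or.inl ⟨ha, hb⟩)))
  · exact Or.inr (Or.inr (Or.inr (Or.inr (Or.inl ⟨ha, hb⟩))))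
  · exact Or.inr (Or.inr (Or.inr (Or.inr (Or.inr ⟨ha, hb⟩))))
  · exact absurd (ha.trans hb.symm) hne

/-- The image of `P₃ = P₁ + P₂`. [folklore] -/
theorem apply_add (g : Γ) : ρ g (P₁ + P₂) = ρ g P₁ + ρ g P₂ := map_add _ _ _

end Triple

/-! ## §3 The generalized dihedral structure: `A` abelian, `τ ∉ A` inverting `A`, `Γ = A ∪ τA` -/

section Dihedral

variable {ρ}
variable {A : Subgroup Γ} {τ : Γ}
  (hconj : ∀ a ∈ A, τ * a * τ⁻¹ = a⁻¹) (hτ : τ ∉ A) (hcover : ∀ g : Γ, g ∈ A ∨ τ⁻¹ * g ∈ A)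
  (hfix : ∀ P : M, P ≠ 0 ∧ (2 : ℕ) • P = 0 → ∃ g : Γ, ρ g P ≠ P)

include hτ hcover in
/-- `τ² ∈ A`. [folklore] -/
theorem tau_sq_mem : τ * τ ∈ A := by
  rcases hcover (τ * τ) with h | h
  · exact h
  · rw [← mul_assoc, inv_mul_cancel, one_mul] at h
    exact absurd h hτ

include hconj in
/-- `τ⁴ = 1`: conjugation by `τ` inverts `τ² ∈ A`. [folklore] -/
theorem tau_pow_four (h2 : τ * τ ∈ A) : τ * τ * (τ * τ) = 1 := by
  have h := hconj _ h2
  have h' : τ * (τ * τ) * τ⁻¹ = τ * τ := by group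
  rw [h'] at h
  -- `h : τ * τ = (τ * τ)⁻¹`
  calc τ * τ * (τ * τ) = τ * τ * (τ * τ)⁻¹ := by rw [← h]
    _ = 1 := mul_inv_cancel _

include hconj in
/-- `b τ = τ b⁻¹` for `b ∈ A`. [folklore] -/
theorem mul_tau_eq {b : Γ} (hb : b ∈ A) : b * τ = τ * b⁻¹ := by
  have h := hconj _ (inv_mem hb)
  rw [inv_inv] at h
  -- `h : τ * b⁻¹ * τ⁻¹ = b`
  calc b * τ = τ * b⁻¹ * τ⁻¹ * τ := by rw [h]
    _ = τ * b⁻¹ := by group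

include hcover hfix in
/-- (H1) Nothing in `M[2] ∖ 0` is fixed by `A` and by `τ`. [folklore] -/
theorem not_fixed {P : M} (hP : P ≠ 0 ∧ (2 : ℕ) • P = 0) (hA : ∀ a ∈ A, ρ a P = P)
    (hτP : ρ τ P = P) : False := by
  obtain ⟨g, hg⟩ := hfix P hP
  apply hg
  rcases hcover g with h | h
  · exact hA g h
  · have : g = τ * (τ⁻¹ * g) := by group
    rw [this, mul_apply, hA _ h, hτP]

include hconj in
/-- (H2) If `P` is `A`-fixed then so is `τP`. [folklore] -/
theorem tau_apply_fixed {P : M} (hA : ∀ a ∈ A, ρ a P = P) : ∀ a ∈ A, ρ a (ρ τ P) = ρ τ P := by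
  intro b hb
  rw [← mul_apply, mul_tau_eq hconj hb, mul_apply, hA _ (inv_mem hb)]

include hconj hτ hcover hfix in
/-- (H3) **No element of `M[2] ∖ 0` is `A`-fixed**, provided `M[2] ∖ 0` has at most three
elements (`hall` for the pair `P, τP`). If `P` were `A`-fixed: `τP` is `A`-fixed (H2); `τP = P`
contradicts (H1); else `P + τP` is `A`-fixed and `τ`-fixed (`τ²P = P` as `τ² ∈ A`), contradicting
(H1). [folklore] -/
theorem exists_apply_ne {P : M} (hP : P ≠ 0 ∧ (2 : ℕ) • P = 0) :
    ∃ a ∈ A, ρ a P ≠ P := by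
  by_contra hcon
  push Not at hcon
  have hτP := tau_apply_fixed hconj hcon
  by_cases heq : ρ τ P = P
  · exact not_fixed hcover hfix hP hcon heq
  · have hτPT := apply_mem ρ τ hP
    have hsum : (P + ρ τ P) ≠ 0 ∧ (2 : ℕ) • (P + ρ τ P) = 0 := add_mem hP hτPT (Ne.symm heq)
    refine not_fixed hcover hfix hsum (fun a ha => ?_) ?_
    · rw [map_add, hcon a ha, hτP a ha]
    · rw [map_add, ← mul_apply, hcon _ (tau_sq_mem hτ hcover), add_comm]

end Dihedral

/-! ## §4 At most three non-zero `2`-torsion elements: exhaustion by a pair -/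

section AtMostThree

variable {ρ}
variable {X : Type*} (φ : M → X) (R : Finset X) (hR : R.card ≤ 3)
  (hφR : ∀ P : M, P ≠ 0 ∧ (2 : ℕ) • P = 0 → φ P ∈ R)
  (hφinj : ∀ P Q : M, P ≠ 0 ∧ (2 : ℕ) • P = 0 → Q ≠ 0 ∧ (2 : ℕ) • Q = 0 → φ P = φ Q → P = Q)

include hR hφR hφinj in
/-- Four pairwise distinct non-zero `2`-torsion elements do not exist (their `φ`-images would be
four distinct elements of `R`, `#R ≤ 3`). [folklore] -/
theorem not_four {P Q S U : M} (hP : P ≠ 0 ∧ (2 : ℕ) • P = 0) (hQ : Q ≠ 0 ∧ (2 : ℕ) • Q = 0)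
    (hS : S ≠ 0 ∧ (2 : ℕ) • S = 0) (hU : U ≠ 0 ∧ (2 : ℕ) • U = 0)
    (hPQ : P ≠ Q) (hPS : P ≠ S) (hPU : P ≠ U) (hQS : Q ≠ S) (hQU : Q ≠ U) (hSU : S ≠ U) :
    False := by
  classical
  have hsub : ({φ P, φ Q, φ S, φ U} : Finset X) ⊆ R := by
    intro x hx
    simp only [Finset.mem_insert, Finset.mem_singleton] at hx
    rcases hx with rfl | rfl | rfl | rfl
    · exact hφR P hP
    · exact hφR Q hQ
    · exact hφR S hS
    · exact hφR U hU
  have hPQ' : φ P ≠ φ Q := fun h => hPQ (hφinj P Q hP hQ h)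
  have hPS' : φ P ≠ φ S := fun h => hPS (hφinj P S hP hS h)
  have hPU' : φ P ≠ φ U := fun h => hPU (hφinj P U hP hU h)
  have hQS' : φ Q ≠ φ S := fun h => hQS (hφinj Q S hQ hS h)
  have hQU' : φ Q ≠ φ U := fun h => hQU (hφinj Q U hQ hU h)
  have hSU' : φ S ≠ φ U := fun h => hSU (hφinj S U hS hU h)
  have hcard : ({φ P, φ Q, φ S, φ U} : Finset X).card = 4 := by
    rw [Finset.card_insert_of_notMem, Finset.card_insert_of_notMem, Finset.card_insert_of_notMem,
      Finset.card_singleton]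
    · simpa only [Finset.mem_singleton] using hSU'
    · simpa only [Finset.mem_insert, Finset.mem_singleton, not_or] using ⟨hQS', hQU'⟩
    · simpa only [Finset.mem_insert, Finset.mem_singleton, not_or] using ⟨hPQ', hPS', hPU'⟩
  have := Finset.card_le_card hsub
  omega

include hR hφR hφinj in
/-- **Exhaustion by a pair.** If `P ≠ Q` are non-zero `2`-torsion elements then every non-zero
`2`-torsion element is `P`, `Q` or `P + Q`. [folklore] -/
theorem eq_or_eq_or_eq_add {P Q : M} (hP : P ≠ 0 ∧ (2 : ℕ) • P = 0) (hQ : Q ≠ 0 ∧ (2 : ℕ) • Q = 0)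
    (hPQ : P ≠ Q) (S : M) (hS : S ≠ 0 ∧ (2 : ℕ) • S = 0) : S = P ∨ S = Q ∨ S = P + Q := by
  by_contra hcon
  push Not at hcon
  obtain ⟨hSP, hSQ, hSR⟩ := hcon
  have hR' := add_mem hP hQ hPQ
  have hPR : P ≠ P + Q := fun h => hQ.1 (left_eq_add.mp h)
  have hQR : Q ≠ P + Q := fun h => hP.1 (left_eq_add.mp (h.trans (add_comm P Q)))
  exact not_four φ R hR hφR hφinj hP hQ hR' hS hPQ hPR (Ne.symm hSP) hQR (Ne.symm hSQ) (Ne.symm hSR)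

end AtMostThree


end Summit.BirchSwinnertonDyer.Uniform.U2.TwoTorsionDihedral
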